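import Literature.Geometry.Symplectic.SteinHandleProfileEstimates
import HarnessLib

/-!
# Assembling Eliashberg's handle profile, IV: positivity of the slope and bounds for the profile

Topic `Literature/Geometry/Symplectic`; proofs file of the fact seat of
`Literature.Geometry.Symplectic.Gompf1998_thm13_twoHandles` (**E2**, `SteinTwoHandles.lean`),
sequel of `SteinHandleProfileEstimates.lean`.  For the `C^∞` variant of Forstnerič–Kozak's
profile (Prop. 3.1 = Eliashberg 1990, Lemma 3.4.3) with the tail-matching parameters
`β⋆ ω`, `r₀⋆ ω`, this file proves, for all sufficiently small `ω > 0`: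

* §1 values of the pieces at the junctions (`Q₀(t₂) = -4/(3σ)`, `Q₂(t₂) = -2/σ`,
  `Q₂(η) = -c₁³/(2η)`, `Q₁(η) = A`, `Q₁(ε) = Q_g(ε) = g''(ε)`), `c₀ ≤ c₁ ≤ g'(ε) ≤ λε`, and
  monotonicity of the start slope (`P₀` is decreasing on `(σ, 3σ)`, `P₀(t_L) ≤ 4`);
* §2 **the slope is positive and at most `4`** on `(σ, ε(1+ω)]`, zone by zone
  (`fp_pos_le_eventually`) — Forstnerič–Kozak: *"`f` is strictly increasing"*;
* §3 **lower bounds for the profile**: `ff ≥ r₀⋆ ω ≥ 1/2` on `(σ, ∞)` (`half_le_r₀s`, `ff_ge_r₀`,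
  from `f(T) = g(T) ≥ 1` and `f' ≤ 4` on the short interval `[t_L, T]`; Forstnerič–Kozak:
  *"`f(t) > 1/2` provided that `ε > 0` is sufficiently small"*), and the sharper
  `ff ≥ m₁ = g(ε) - (c₁ε + Aε²/2 + g''(ε)ε²/6 + ε²)` from the start of the convex region on
  (`ff_ge_m₁_eventually`), which is what the inequalities (3.2) need near `t = ε` when `λ`
  is close to `1`.

Everything is **proved**; two definitions (`Pi₁`, `m₁`), no named fact.

## References

* F. Forstnerič, J. Kozak, *Strongly pseudoconvex handlebodies*, J. Korean Math. Soc. 40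
  (2003), 727–745 (arXiv:math/0305237), Prop. 3.1 and its proof. [ForstnericKozak2003]
* Ya. Eliashberg, *Topological characterization of Stein manifolds of dimension > 2*,
  Internat. J. Math. 1 (1990), 29–46, Lemma 3.4.3. [Eliashberg1990Stein]
-/

noncomputable section

open Set Filter MeasureTheory intervalIntegral
open scoped Topology ContDiff

namespace Literature.Geometry.Symplectic

namespace HParam

variable {P : HParam}

/-! ### §1 Values at the junctions; sizes of the constants -/

/-- `Q₀(t₂) = -4/(3σ)`. [folklore] -/
theorem Q₀_t₂ (h : P.Pos) : P.Q₀ P.t₂ = -(4 / (3 * P.σ)) := by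
  have hσ := h.σ_pos
  rw [Q₀, t₂_eq, show 2 * P.σ - P.σ = P.σ by ring, startLog, div_self hσ.ne', Real.log_one, add_zero]
  field_simp
  norm_num

/-- `Q₂(t₂) = -2/σ`. [folklore] -/
theorem Q₂_t₂ (h : P.Pos) : P.Q₂ P.t₂ = -(2 / P.σ) := by
  have hσ := h.σ_pos
  rw [Q₂, descSlope_t₂ h, t₂_eq]
  field_simp

/-- `Q₂(η) = -c₁³/(2η)`. [folklore] -/
theorem Q₂_η (h : P.Pos) : P.Q₂ P.η = -(P.c₁ ^ 3 / (2 * P.η)) := by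
  rw [Q₂, descSlope_η h, neg_div]

/-- `Q₁(η) = A`. [folklore] -/
theorem Q₁_η : P.Q₁ P.η = P.A := by simp [Q₁]

/-- `Q₁(ε) = g''(ε)` (`B` was chosen for this). [folklore] -/
theorem Q₁_ε (h : P.Pos) : P.Q₁ P.ε = P.gppε := by
  have hne : P.ε - P.η ≠ 0 := by have := h.η_lt; have := h.ε_pos; linarith [h.η_pos]
  rw [Q₁, B]; field_simp; ring

/-- `Q_g(ε) = g''(ε)`. [folklore] -/
theorem Qg_ε : P.Qg P.ε = P.gppε := rfl

/-- The extra smallness hypotheses on `(λ, ε)` used from now on (all hold for every `λ > 1`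
once `ε` is small; recorded as hypotheses, discharged in the sequel). [folklore] -/
structure Small : Prop extends P.Pos where
  ε_le : P.ε ≤ 1 / 20
  lε_le : P.l * P.ε ≤ 1
  A_le_gppε : P.A ≤ P.gppε
  c₀_le : P.c₀ ≤ P.l * P.ε

/-- `A > 1`. [folklore] -/
theorem Pos.one_lt_A (h : P.Pos) : 1 < P.A := by rw [A]; linarith [h.one_lt_l]

/-- `B ≥ 0`. [folklore] -/
theorem Small.B_nonneg (h : P.Small) : 0 ≤ P.B := by
  rw [B]; exact div_nonneg (by linarith [h.A_le_gppε]) (by linarith [h.η_lt, h.ε_pos, h.η_pos])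

/-- `Q₁ ≥ A` on `t ≥ η`. [folklore] -/
theorem Small.A_le_Q₁ (h : P.Small) {t : ℝ} (ht : P.η ≤ t) : P.A ≤ P.Q₁ t := by
  rw [Q₁]; nlinarith [h.B_nonneg]

/-- `c₀ ≤ c₁`. [folklore] -/
theorem Pos.c₀_le_c₁ (h : P.Pos) (hA : P.A ≤ P.gppε) : P.c₀ ≤ P.c₁ := by
  rw [c₀, c₁]
  have h1 : 0 ≤ P.A + P.gppε := by linarith [h.one_lt_A]
  nlinarith [h.η_pos, h1]

/-- `η ≤ c₁³/40`. [folklore] -/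
theorem Small.η_le (h : P.Small) : P.η ≤ P.c₁ ^ 3 / 40 := by
  have := pow_le_pow_left₀ h.c₀_pos.le (h.toPos.c₀_le_c₁ h.A_le_gppε) 3
  rw [η]; linarith

/-- `Q₀ < 0` on `(σ, 3σ)`: the start slope is decreasing. [folklore] -/
theorem Q₀_neg (h : P.Pos) {t : ℝ} (ht : P.σ < t) (ht3 : t < 3 * P.σ) : P.Q₀ t < 0 := by
  have hs : 0 < t - P.σ := by linarith
  have hL := startLog_pos_of_lt ht ht3
  -- `L > 2`
  have hL2 : 2 < startLog P.σ 6 (t - P.σ) := by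
    rw [startLog]
    have h1 : Real.log (P.σ / (t - P.σ)) ≥ Real.log (1 / 2) := by
      apply Real.log_le_log (by norm_num)
      rw [div_le_div_iff₀ (by norm_num) hs]; linarith
    have h2 : Real.log (1 / 2) = -Real.log 2 := by rw [one_div, Real.log_inv]
    have h3 : Real.log 2 ≤ 1 := by
      have := Real.log_le_sub_one_of_pos (by norm_num : (0:ℝ) < 2); linarith
    linarith
  rw [Q₀]
  have hA : 0 < 2 * P.σ * 6 ^ 2 / ((t - P.σ) ^ 2 * startLog P.σ 6 (t - P.σ) ^ 2) := by
    have := h.σ_pos; positivity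
  have hB : 0 < 1 - 2 / startLog P.σ 6 (t - P.σ) := by
    rw [sub_pos, div_lt_one hL]; exact hL2
  nlinarith [mul_pos hA hB]

/-- `P₀` is decreasing on `(σ, 3σ)`. [folklore] -/
theorem P₀_antitoneOn (h : P.Pos) {t t' : ℝ} (ht : P.σ < t) (htt' : t ≤ t') (ht'3 : t' < 3 * P.σ) :
    P.P₀ t' ≤ P.P₀ t := by
  have hd : ∀ x ∈ Icc t t', HasDerivAt P.P₀ (P.Q₀ x) x := fun x hx =>
    hasDerivAt_P₀ h (lt_of_lt_of_le ht hx.1) (lt_of_le_of_lt hx.2 ht'3)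
  have hcont : ContinuousOn P.P₀ (Icc t t') := fun x hx => (hd x hx).continuousAt.continuousWithinAt
  have hdiff : DifferentiableOn ℝ P.P₀ (interior (Icc t t')) := fun x hx =>
    (hd x (interior_subset hx)).differentiableAt.differentiableWithinAt
  have hle : ∀ x ∈ interior (Icc t t'), deriv P.P₀ x ≤ 0 := by
    intro x hx
    rw [interior_Icc] at hx
    rw [(hd x ⟨hx.1.le, hx.2.le⟩).deriv]
    exact (Q₀_neg h (lt_trans ht hx.1) (lt_trans hx.2 ht'3)).le
  have hmv := (convex_Icc t t').image_sub_le_mul_sub_of_deriv_le hcont hdiff hle t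
    (left_mem_Icc.2 htt') t' (right_mem_Icc.2 htt') htt'
  linarith

/-- `P₀(t_L) ≤ 4` (`P₀(t_L) = 144/(6 + log 2)² ≤ 144/36`). [folklore] -/
theorem P₀_tL_le (h : P.Pos) : P.P₀ P.tL ≤ 4 := by
  have hσ := h.σ_pos
  have hs : P.tL - P.σ = P.σ / 2 := by rw [tL_eq]; ring
  have hL : startLog P.σ 6 (P.tL - P.σ) = 6 + Real.log 2 := by
    rw [hs, startLog]; congr 1; field_simp
  have hlog : 0 ≤ Real.log 2 := Real.log_nonneg (by norm_num)
  rw [P₀, startSlope, hL, hs]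
  rw [div_le_iff₀ (by positivity)]
  nlinarith [sq_nonneg (Real.log 2)]

/-- `c₁ ≤ descSlope t ≤ 2` for `t₂ ≤ t ≤ η`. [folklore] -/
theorem descSlope_mem (h : P.Pos) {t : ℝ} (h1 : P.t₂ ≤ t) (h2 : t ≤ P.η) :
    P.c₁ ≤ descSlope P.Cc P.η t ∧ descSlope P.Cc P.η t ≤ 2 := by
  have hη := h.η_pos
  have ht₂ := h.t₂_pos
  have h85 : 8 * P.σ / 5 < P.t₂ := by rw [t₂_eq]; linarith [h.σ_pos]
  have hD₂ : 0 < P.Cc + Real.log (P.t₂ / P.η) := descDomain h h85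
  have hDt : 0 < P.Cc + Real.log (t / P.η) := descDomain h (lt_of_lt_of_le h85 h1)
  constructor
  · rw [← descSlope_η h]
    exact descSlope_antitone hη (lt_of_lt_of_le ht₂ h1) h2 hDt
  · rw [← descSlope_t₂ h]
    exact descSlope_antitone hη ht₂ h1 hD₂

/-- `P₁` is increasing on `t ≥ η`: `P₁ t - P₁ a ≥ A (t - a)` for `η ≤ a ≤ t`. [folklore] -/
theorem Small.P₁_sub_ge (h : P.Small) {a t : ℝ} (ha : P.η ≤ a) (hat : a ≤ t) :
    P.A * (t - a) ≤ P.P₁ t - P.P₁ a := by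
  have hB := h.B_nonneg
  have : P.P₁ t - P.P₁ a = P.A * (t - a) + P.B * ((t - P.η) ^ 2 - (a - P.η) ^ 2) / 2 := by
    simp only [P₁]; ring
  rw [this]
  have h2 : 0 ≤ (t - P.η) ^ 2 - (a - P.η) ^ 2 := by nlinarith
  nlinarith

/-- `P₁ t ≤ g'(ε)` for `η ≤ t ≤ ε`. [folklore] -/
theorem Small.P₁_le (h : P.Small) {t : ℝ} (h1 : P.η ≤ t) (h2 : t ≤ P.ε) : P.P₁ t ≤ P.gpε := by
  rw [← P₁_ε h.toPos]
  have := h.P₁_sub_ge h1 h2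
  nlinarith [h.toPos.one_lt_A]

/-- `0 < g'(ε) ≤ λε ≤ 1`. [folklore] -/
theorem Small.gpε_bounds (h : P.Small) : 0 < P.gpε ∧ P.gpε ≤ P.l * P.ε := by
  have hp := h.toPos
  have hε := hp.ε_pos
  have hl : 0 < P.l := by linarith [hp.one_lt_l]
  have hg1 : 1 ≤ quadric P.l P.ε := by
    rw [quadric]; exact Real.one_le_sqrt.2 (by nlinarith)
  refine ⟨by rw [gpε, gε]; exact div_pos (mul_pos hl hε) (quadric_pos hp.l_nonneg _), ?_⟩
  rw [gpε, gε, div_le_iff₀ (quadric_pos hp.l_nonneg _)]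
  nlinarith [mul_pos hl hε]

/-! ### §2 Positivity and boundedness of the slope -/

set_option maxHeartbeats 800000 in
/-- **`0 < fp` on `(σ, ε(1+ω)]` and `fp ≤ 4` on `[t_L, ε(1+ω)]` for all small `ω > 0`**
(with `β = β⋆ ω`), zone by zone: the exact start (`f' = P₀ ≥ 2`, decreasing, `P₀(t_L) ≤ 4`),
the three windows (`f'` close to `2`, `c₁`, `g'(ε)`), the descending region
(`f' = descSlope + δ₁ ∈ [0.9 c₁, 2.1]`) and the convex region (`f' = f'(a₃) + P₁ - P₁(a₃) + β∫ψ`).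
[cite: ForstnericKozak2003, Prop. 3.1] -/
theorem fp_pos_le_eventually (h : P.Small) :
    ∀ᶠ om in 𝓝[>] 0, 0 < om ∧ om ≤ 1 / 8 ∧ ∀ t, P.σ < t → t ≤ P.ε * (1 + om) →
      0 < P.fp om (P.βs om) t ∧ (P.tL ≤ t → P.fp om (P.βs om) t ≤ 4) := by
  have hp := h.toPos
  have hσ := hp.σ_pos
  have hη := hp.η_pos
  have hε := hp.ε_pos
  have hc₁ := hp.c₁_pos
  have hc₁1 := hp.c₁_le
  obtain ⟨hgp, hgpl⟩ := h.gpε_bounds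
  have e1 := fp_win₁_tendsto hp (0 : ℝ) (δ := 1) one_pos
  have e2 := fp_win₂_tendsto hp (0 : ℝ) (δ := P.c₁ / 10) (by positivity)
  have e3 := fp_win₃_tendsto hp (δ := P.gpε / 2) (half_pos hgp)
  have e4 : ∀ᶠ om in 𝓝[>] 0, |P.δ₁ om 0| < P.c₁ / 10 := by
    have := (Metric.tendsto_nhds.1 (δ₁_tendsto hp 0)) (P.c₁ / 10) (by positivity)
    filter_upwards [this] with om hom; rwa [Real.dist_eq, sub_zero] at hom
  have e5 : ∀ᶠ om in 𝓝[>] 0, |P.βs om| < 1 / 2 := by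
    have := (Metric.tendsto_nhds.1 (βs_tendsto hp)) (1 / 2) (by norm_num)
    filter_upwards [this] with om hom; rwa [Real.dist_eq, sub_zero] at hom
  have e6 : ∀ᶠ om in 𝓝[>] 0, |P.P₁ (P.η * (1 + om)) - P.c₁| < P.c₁ / 10 := by
    have hB1 : Tendsto (fun om => P.P₁ (P.η * (1 + om))) (𝓝[>] 0) (𝓝 P.c₁) := by
      rw [← P₁_η (P := P)]; exact tendsto_comp_one_add continuous_P₁.continuousAt
    have := (Metric.tendsto_nhds.1 hB1) (P.c₁ / 10) (by positivity)
    filter_upwards [this] with om hom; rwa [Real.dist_eq] at hom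
  have e7 := eventually_pos_lt (c := 1 / 8) (by norm_num)
  filter_upwards [e1, e2, e3, e4, e5, e6, e7] with om h1 h2 h3 h4 h5 h6 h7
  obtain ⟨hom, hom8⟩ := h7
  refine ⟨hom, hom8.le, fun t hσt htT => ?_⟩
  obtain ⟨s1, s2, s3⟩ := hp.sizes hom.le hom8.le
  have ht₂ := t₂_eq P
  have hA1 := hp.one_lt_A
  -- `fp om βs = fp om 0` left of `3ε/10`
  have hind : ∀ x, P.σ < x → x ≤ 3 * P.ε / 10 → P.fp om (P.βs om) x = P.fp om 0 x := fun x hx hx' =>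
    fp_indep_β hp hom hom8.le _ hx hx'
  have ha₃σ : P.σ < P.η * (1 + om) := by
    have := hp.t₂_pos; rw [ht₂] at s1 this; nlinarith
  -- the value at `a₃`
  have hfa : |P.fp om (P.βs om) (P.η * (1 + om)) - P.c₁| < P.c₁ / 10 := by
    rw [hind _ ha₃σ s2]
    exact h2 _ ⟨by nlinarith, le_rfl⟩
  by_cases z0 : t ≤ P.t₂ * (1 - om)
  · -- exact start zone
    rw [fp_eq_P₀ hp hom hom8.le _ hσt z0]
    have h2σ : t ≤ 2 * P.σ := by rw [ht₂] at z0; nlinarith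
    have hge : 2 ≤ P.P₀ t := two_le_startSlope hσ (by norm_num) hσt h2σ
    exact ⟨by linarith, fun htL => (P₀_antitoneOn hp hp.σ_lt_tL htL (by linarith)).trans (P₀_tL_le hp)⟩
  rw [not_le] at z0
  have htL : P.tL ≤ t := by rw [tL_eq]; rw [ht₂] at z0; nlinarith
  by_cases z1 : t ≤ P.t₂ * (1 + om)
  · -- first window
    have hw := h1 t ⟨z0.le, z1⟩
    rw [← hind t hσt (by linarith [s1, s2, show P.η * (1 - om) ≤ P.η * (1 + om) by nlinarith])] at hw
    rw [abs_lt] at hw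
    exact ⟨by linarith, fun _ => by linarith⟩
  rw [not_le] at z1
  by_cases z2 : t ≤ P.η * (1 - om)
  · -- descending region
    have hdesc := fp_desc hp hom hom8.le (P.βs om) z1.le z2
    have hδ : P.δ₁ om (P.βs om) = P.δ₁ om 0 := by
      rw [δ₁, δ₁, hind _ (by rw [ht₂]; nlinarith) (s1.trans (by nlinarith))]
    rw [hδ] at hdesc
    have hη' : t ≤ P.η := z2.trans (by nlinarith)
    obtain ⟨hlo, hhi⟩ := descSlope_mem hp (by nlinarith [hp.t₂_pos] : P.t₂ ≤ t) hη'
    rw [abs_lt] at h4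
    rw [hdesc]
    exact ⟨by linarith, fun _ => by linarith⟩
  rw [not_le] at z2
  by_cases z3 : t ≤ P.η * (1 + om)
  · -- second window
    have hw := h2 t ⟨z2.le, z3⟩
    rw [← hind t hσt (z3.trans s2)] at hw
    rw [abs_lt] at hw
    exact ⟨by linarith, fun _ => by linarith⟩
  rw [not_le] at z3
  by_cases z4 : t ≤ P.ε * (1 - om)
  · -- convex region
    have hconv := fp_convex_eq hp hom hom8.le (P.βs om) z3.le z4
    have hηa : P.η ≤ P.η * (1 + om) := by nlinarith
    have hP : P.A * (t - P.η * (1 + om)) ≤ P.P₁ t - P.P₁ (P.η * (1 + om)) :=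
      h.P₁_sub_ge hηa z3.le
    have hta : 0 ≤ t - P.η * (1 + om) := by linarith
    have hψI : |P.βs om * ∫ x in (P.η * (1 + om))..t, P.ψ x| ≤ 1 / 2 * (t - P.η * (1 + om)) := by
      rw [abs_mul]
      have h8 : |∫ x in (P.η * (1 + om))..t, P.ψ x| ≤ 1 * |t - P.η * (1 + om)| :=
        abs_integral_le_of_abs_le fun x _ => by rw [abs_of_nonneg (ψ_nonneg x)]; exact ψ_le_one x
      have hta' : |t - P.η * (1 + om)| = t - P.η * (1 + om) := abs_of_nonneg hta
      rw [hta', one_mul] at h8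
      exact mul_le_mul h5.le h8 (abs_nonneg _) (by norm_num)
    rw [abs_le] at hψI
    rw [abs_lt] at hfa h6
    have htε : t ≤ P.ε := z4.trans (by nlinarith)
    have hP₁t : P.P₁ t ≤ P.gpε := h.P₁_le (hηa.trans z3.le) htε
    have hprod : 0 ≤ (P.A - 1 / 2) * (t - P.η * (1 + om)) := mul_nonneg (by linarith) hta
    have hlε := h.lε_le
    have hε20 := h.ε_le
    have hprod' : 1 / 2 * (t - P.η * (1 + om)) ≤ P.A * (t - P.η * (1 + om)) := by
      have : (P.A - 1 / 2) * (t - P.η * (1 + om)) = P.A * (t - P.η * (1 + om)) - 1 / 2 * (t - P.η * (1 + om)) := by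
        ring
      linarith
    constructor
    · rw [hconv]; linarith [hψI.1]
    · intro _; rw [hconv]
      linarith [hψI.2]
  rw [not_le] at z4
  · -- third window
    have hw := h3 t ⟨z4.le, htT⟩
    rw [abs_lt] at hw
    have := h.lε_le
    exact ⟨by linarith, fun _ => by linarith⟩

/-! ### §3 Lower bounds for the profile -/

/-- **`f ≥ r₀⋆`**: the profile is at least its starting height, on `(σ, ε(1+ω)]`, whenever the
slope is positive there (`0 < ω ≤ 1/8`). [cite: ForstnericKozak2003, Prop. 3.1] -/
theorem ff_ge_r₀ (h : P.Pos) {om : ℝ} (hom : 0 < om) (hom8 : om ≤ 1 / 8)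
    (hpos : ∀ t, P.σ < t → t ≤ P.ε * (1 + om) → 0 < P.fp om (P.βs om) t) {t : ℝ}
    (hσt : P.σ < t) (htT : t ≤ P.ε * (1 + om)) :
    P.r₀s om < P.ff om (P.βs om) (P.r₀s om) t := by
  have hσ := h.σ_pos
  have ht₂ := t₂_eq P
  -- on the start zone `ff = startFn r₀ > r₀`
  have hstart : ∀ s, P.σ < s → s ≤ P.t₂ * (1 - om) → P.r₀s om < P.ff om (P.βs om) (P.r₀s om) s := by
    intro s hs hs2
    rw [ff_eq_startFn h hom hom8 _ _ hs hs2]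
    exact lt_startFn hσ (by norm_num) (startLog_pos_of_lt hs (by rw [ht₂] at hs2; nlinarith))
  by_cases z0 : t ≤ P.t₂ * (1 - om)
  · exact hstart t hσt z0
  · rw [not_le] at z0
    set s := P.t₂ * (1 - om) with hsdef
    have hσs : P.σ < s := by rw [hsdef, ht₂]; nlinarith
    have h1 := hstart s hσs le_rfl
    -- `ff t - ff s = ∫_s^t fp ≥ 0`
    have hσx : ∀ x ∈ uIcc s t, P.σ < x ∧ x ≤ P.ε * (1 + om) := fun x hx => by
      rw [uIcc_of_le z0.le] at hx; exact ⟨lt_of_lt_of_le hσs hx.1, hx.2.trans htT⟩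
    have hderiv : ∀ x ∈ uIcc s t, HasDerivAt (P.ff om (P.βs om) (P.r₀s om)) (P.fp om (P.βs om) x) x :=
      fun x hx => hasDerivAt_ff h hom hom8 _ _ (hσx x hx).1
    have hint : IntervalIntegrable (P.fp om (P.βs om)) volume s t :=
      ((contDiffOn_fp h hom hom8 _).continuousOn.mono fun x hx => (hσx x hx).1).intervalIntegrable
    have hI := integral_eq_sub_of_hasDerivAt hderiv hint
    have hnn : 0 ≤ ∫ x in s..t, P.fp om (P.βs om) x :=
      integral_nonneg z0.le fun x hx => (hpos x (lt_of_lt_of_le hσs hx.1) (hx.2.trans htT)).le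
    linarith

/-- **`r₀⋆ ≥ 1/2`** when `0 < fp ≤ 4` on `[t_L, T]` (`ε ≤ 1/20`): `r₀⋆ = g(T) - w₀/L(σ/2) - ∫_{t_L}^T f'`
with `g(T) ≥ 1`, `w₀/L(σ/2) ≤ 12σ ≤ 3ε/2` and `∫ f' ≤ 4T ≤ 9ε/2`. [cite: ForstnericKozak2003, Prop. 3.1] -/
theorem half_le_r₀s (h : P.Small) {om : ℝ} (hom : 0 < om) (hom8 : om ≤ 1 / 8)
    (hb : ∀ t, P.σ < t → t ≤ P.ε * (1 + om) → 0 < P.fp om (P.βs om) t ∧ (P.tL ≤ t → P.fp om (P.βs om) t ≤ 4)) :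
    1 / 2 ≤ P.r₀s om := by
  have hp := h.toPos
  have hσ := hp.σ_pos
  have hε := hp.ε_pos
  have hσε := hp.σ_lt_ε
  have hε10 := h.ε_le
  set T := P.ε * (1 + om) with hT
  have htLT : P.tL ≤ T := by rw [tL_eq, hT]; nlinarith
  have hσtL := hp.σ_lt_tL
  -- `r₀⋆ = g(T) - (w₀/L + ∫ fp)`
  have hr : P.r₀s om = quadric P.l T - (2 * P.σ * 6 ^ 2 / startLog P.σ 6 (P.tL - P.σ) +
      ∫ x in P.tL..T, P.fp om (P.βs om) x) := by
    rw [r₀s, ff, startFn]; ring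
  have hg1 : 1 ≤ quadric P.l T := by
    rw [quadric]; exact Real.one_le_sqrt.2 (by nlinarith [hp.l_nonneg, sq_nonneg T])
  -- `w₀/L(σ/2) ≤ 12 σ`
  have hL : 6 ≤ startLog P.σ 6 (P.tL - P.σ) := by
    have := le_startLog (σ := P.σ) (L₀ := 6) (s := P.tL - P.σ) (by rw [tL_eq]; linarith) (by rw [tL_eq]; linarith)
    exact this
  have hw : 2 * P.σ * 6 ^ 2 / startLog P.σ 6 (P.tL - P.σ) ≤ 12 * P.σ := by
    rw [div_le_iff₀ (by linarith)]; nlinarith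
  -- `∫ fp ≤ 4 (T - t_L)`
  have hI : ∫ x in P.tL..T, P.fp om (P.βs om) x ≤ 4 * (T - P.tL) := by
    have h1 : ∫ x in P.tL..T, P.fp om (P.βs om) x ≤ ∫ x in P.tL..T, (4 : ℝ) := by
      apply integral_mono_on htLT
      · exact ((contDiffOn_fp hp hom hom8 _).continuousOn.mono fun x hx => by
          rw [uIcc_of_le htLT] at hx; exact lt_of_lt_of_le hσtL hx.1).intervalIntegrable
      · exact continuous_const.intervalIntegrable _ _
      · intro x hx; exact (hb x (lt_of_lt_of_le hσtL hx.1) hx.2).2 hx.1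
    rw [intervalIntegral.integral_const, smul_eq_mul] at h1
    linarith
  have hT' : T ≤ 9 * P.ε / 8 := by rw [hT]; nlinarith
  rw [hr]
  have h1 : 1 - 12 * P.σ - 4 * (T - P.tL) ≤ quadric P.l T - (2 * P.σ * 6 ^ 2 / startLog P.σ 6 (P.tL - P.σ) +
      ∫ x in P.tL..T, P.fp om (P.βs om) x) := by linarith
  have h2 : 0 < P.tL := by linarith
  linarith

/-- The antiderivative of the ideal slope on the convex region,
`Pi₁(t) = c₁(t - η) + A(t - η)²/2 + B(t - η)³/6`. [folklore] -/
def Pi₁ (P : HParam) (t : ℝ) : ℝ := P.c₁ * (t - P.η) + P.A * (t - P.η) ^ 2 / 2 + P.B * (t - P.η) ^ 3 / 6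

/-- `Pi₁' = P₁`. [folklore] -/
theorem hasDerivAt_Pi₁ (t : ℝ) : HasDerivAt P.Pi₁ (P.P₁ t) t := by
  have h1 : HasDerivAt (fun t => t - P.η) 1 t := (hasDerivAt_id' t).sub_const _
  have h2 := ((h1.pow 2).const_mul P.A).div_const 2
  have h3 := ((h1.pow 3).const_mul P.B).div_const 6
  have h4 := (h1.const_mul P.c₁).add h2 |>.add h3
  refine (h4.congr_of_eventuallyEq (Eventually.of_forall fun t' => by simp [Pi₁])).congr_deriv ?_
  simp [P₁]; ring

/-- **The sharper lower bound** `m₁ = g(ε) - (c₁ε + Aε²/2 + g''(ε)ε²/6 + ε²)` for the profile on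
the convex region and beyond. [folklore] -/
def m₁ (P : HParam) : ℝ := quadric P.l P.ε - (P.c₁ * P.ε + P.A * P.ε ^ 2 / 2 + P.gppε * P.ε ^ 2 / 6 + P.ε ^ 2)

/-- `Pi₁(b) - Pi₁(a) ≤ c₁ε + Aε²/2 + g''(ε)ε²/6` for `η ≤ a ≤ b ≤ ε`. [folklore] -/
theorem Small.Pi₁_sub_le (h : P.Small) {a b : ℝ} (ha : P.η ≤ a) (hab : a ≤ b) (hb : b ≤ P.ε) :
    P.Pi₁ b - P.Pi₁ a ≤ P.c₁ * P.ε + P.A * P.ε ^ 2 / 2 + P.gppε * P.ε ^ 2 / 6 := by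
  have hp := h.toPos
  have hc₁ := hp.c₁_pos
  have hA := hp.one_lt_A
  have hB := h.B_nonneg
  have hε := hp.ε_pos
  have hη := hp.η_pos
  -- `Pi₁ b - Pi₁ a ≤ Pi₁ ε - Pi₁ η = Pi₁ ε` (monotone, `P₁ > 0` on `[η, ε]`), then expand
  have hmono : ∀ {u v}, P.η ≤ u → u ≤ v → P.Pi₁ u ≤ P.Pi₁ v := by
    intro u v hu huv
    have : P.Pi₁ v - P.Pi₁ u = (v - u) * (P.c₁ + P.A * ((v - P.η) + (u - P.η)) / 2 +
        P.B * ((v - P.η) ^ 2 + (v - P.η) * (u - P.η) + (u - P.η) ^ 2) / 6) := by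
      simp only [Pi₁]; ring
    have h2 : 0 ≤ (v - P.η) ^ 2 + (v - P.η) * (u - P.η) + (u - P.η) ^ 2 := by nlinarith
    have hf2 : 0 ≤ P.c₁ + P.A * ((v - P.η) + (u - P.η)) / 2 +
        P.B * ((v - P.η) ^ 2 + (v - P.η) * (u - P.η) + (u - P.η) ^ 2) / 6 := by
      have h3 : 0 ≤ P.A * ((v - P.η) + (u - P.η)) := mul_nonneg (by linarith) (by linarith)
      have h4 : 0 ≤ P.B * ((v - P.η) ^ 2 + (v - P.η) * (u - P.η) + (u - P.η) ^ 2) := mul_nonneg hB h2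
      linarith
    rw [← sub_nonneg, this]
    exact mul_nonneg (sub_nonneg.2 huv) hf2
  have h1 : P.Pi₁ b - P.Pi₁ a ≤ P.Pi₁ P.ε - P.Pi₁ P.η := by
    have := hmono ha le_rfl
    have := hmono (ha.trans hab) hb
    have := hmono le_rfl ha
    linarith [hmono (le_rfl : P.η ≤ P.η) ha]
  have h2 : P.Pi₁ P.η = 0 := by simp [Pi₁]
  have hεη : 0 ≤ P.ε - P.η := by linarith [hp.η_lt]
  have h3 : P.Pi₁ P.ε ≤ P.c₁ * P.ε + P.A * P.ε ^ 2 / 2 + P.gppε * P.ε ^ 2 / 6 := by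
    rw [Pi₁]
    have hBε : P.B * (P.ε - P.η) = P.gppε - P.A := by
      rw [B]; field_simp [show P.ε - P.η ≠ 0 by linarith [hp.η_lt]]
    have h4 : P.B * (P.ε - P.η) ^ 3 / 6 = (P.gppε - P.A) * (P.ε - P.η) ^ 2 / 6 := by
      rw [← hBε]; ring
    rw [h4]
    have h5 : (P.ε - P.η) ^ 2 ≤ P.ε ^ 2 := by nlinarith
    have hg : 0 ≤ P.gppε := by linarith [h.A_le_gppε]
    have hk : 0 ≤ P.A / 3 + P.gppε / 6 := by positivity
    have h6 := mul_le_mul_of_nonneg_left h5 hk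
    have h7 : P.c₁ * (P.ε - P.η) + P.A * (P.ε - P.η) ^ 2 / 2 + (P.gppε - P.A) * (P.ε - P.η) ^ 2 / 6 =
        P.c₁ * (P.ε - P.η) + (P.A / 3 + P.gppε / 6) * (P.ε - P.η) ^ 2 := by ring
    rw [h7]
    have h8 : (P.A / 3 + P.gppε / 6) * P.ε ^ 2 ≤ P.A * P.ε ^ 2 / 2 + P.gppε * P.ε ^ 2 / 6 := by
      nlinarith [sq_nonneg P.ε]
    nlinarith [mul_nonneg hc₁.le hη.le]
  linarith

set_option maxHeartbeats 800000 in
/-- **`f ≥ m₁` from the start of the convex region on**, for all small `ω > 0`: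
`f(t) = g(T) - ∫_t^T f' ≥ g(ε) - ∫_{η(1+ω)}^T f'` and the last integral is at most
`Pi₁(ε(1-ω)) - Pi₁(η(1+ω))` plus terms which are small with `ω`.
[cite: ForstnericKozak2003, Prop. 3.1] -/
theorem ff_ge_m₁_eventually (h : P.Small) :
    ∀ᶠ om in 𝓝[>] 0, ∀ t, P.η * (1 + om) ≤ t → t ≤ P.ε * (1 + om) →
      P.m₁ ≤ P.ff om (P.βs om) (P.r₀s om) t := by
  have hp := h.toPos
  have hσ := hp.σ_pos
  have hη := hp.η_pos
  have hε := hp.ε_pos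
  have hc₁ := hp.c₁_pos
  obtain ⟨hgp, hgpl⟩ := h.gpε_bounds
  have e0 := fp_pos_le_eventually h
  have e2 := fp_win₂_tendsto hp (0 : ℝ) (δ := P.ε ^ 2 / 4) (by positivity)
  have e3 := fp_win₃_tendsto hp (δ := 1) one_pos
  have e5 : ∀ᶠ om in 𝓝[>] 0, |P.βs om| < P.ε / 4 := by
    have := (Metric.tendsto_nhds.1 (βs_tendsto hp)) (P.ε / 4) (by positivity)
    filter_upwards [this] with om hom; rwa [Real.dist_eq, sub_zero] at hom
  have e6 : ∀ᶠ om in 𝓝[>] 0, |P.P₁ (P.η * (1 + om)) - P.c₁| < P.ε ^ 2 / 4 := by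
    have hB1 : Tendsto (fun om => P.P₁ (P.η * (1 + om))) (𝓝[>] 0) (𝓝 P.c₁) := by
      rw [← P₁_η (P := P)]; exact tendsto_comp_one_add continuous_P₁.continuousAt
    have := (Metric.tendsto_nhds.1 hB1) (P.ε ^ 2 / 4) (by positivity)
    filter_upwards [this] with om hom; rwa [Real.dist_eq] at hom
  have e7 := eventually_pos_lt (c := min (1 / 8) (P.ε / (8 * (P.gpε + 1) + 1))) (by positivity)
  filter_upwards [e0, e2, e3, e5, e6, e7] with om h0 h2 h3 h5 h6 h7 t hat htT
  obtain ⟨hom, hom8, hb⟩ := h0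
  obtain ⟨-, hlt⟩ := h7
  rw [lt_min_iff] at hlt
  obtain ⟨-, homε⟩ := hlt
  obtain ⟨s1, s2, s3⟩ := hp.sizes hom.le hom8
  have ht₂ := t₂_eq P
  set a := P.η * (1 + om) with ha
  set b := P.ε * (1 - om) with hbb
  set T := P.ε * (1 + om) with hT
  have hab : a ≤ b := s2.trans s3
  have hbT : b ≤ T := by rw [hbb, hT]; nlinarith
  have hσa : P.σ < a := by have := hp.t₂_pos; rw [ht₂] at s1 this; rw [ha]; nlinarith
  -- `ff t = g(T) - ∫_t^T fp ≥ g(T) - ∫_a^T fp`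
  have hσx : ∀ x ∈ uIcc a T, P.σ < x ∧ x ≤ T := fun x hx => by
    rw [uIcc_of_le (hab.trans hbT)] at hx; exact ⟨lt_of_lt_of_le hσa hx.1, hx.2⟩
  have hderiv : ∀ x ∈ uIcc a T, HasDerivAt (P.ff om (P.βs om) (P.r₀s om)) (P.fp om (P.βs om) x) x :=
    fun x hx => hasDerivAt_ff hp hom hom8 _ _ (hσx x hx).1
  have hintA : IntervalIntegrable (P.fp om (P.βs om)) volume a T :=
    ((contDiffOn_fp hp hom hom8 _).continuousOn.mono fun x hx => (hσx x hx).1).intervalIntegrable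
  have hfpi : ∀ u v, a ≤ u → u ≤ v → v ≤ T → IntervalIntegrable (P.fp om (P.βs om)) volume u v := by
    intro u v hu huv hv
    exact ((contDiffOn_fp hp hom hom8 _).continuousOn.mono fun x hx => by
      rw [uIcc_of_le huv] at hx; exact lt_of_lt_of_le hσa (hu.trans hx.1)).intervalIntegrable
  have hIt : ∫ x in t..T, P.fp om (P.βs om) x = quadric P.l T - P.ff om (P.βs om) (P.r₀s om) t := by
    have hsub : uIcc t T ⊆ uIcc a T := by
      rw [uIcc_of_le htT, uIcc_of_le (hab.trans hbT)]; exact Icc_subset_Icc_left hat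
    rw [integral_eq_sub_of_hasDerivAt (fun x hx => hderiv x (hsub hx)) (hfpi t T hat htT le_rfl),
      ff_eq_quadric hp hom hom8 le_rfl]
  have hsplit : ∫ x in a..T, P.fp om (P.βs om) x =
      (∫ x in a..t, P.fp om (P.βs om) x) + ∫ x in t..T, P.fp om (P.βs om) x :=
    (integral_add_adjacent_intervals (hfpi a t le_rfl hat htT) (hfpi t T hat htT le_rfl)).symm
  have hnn : 0 ≤ ∫ x in a..t, P.fp om (P.βs om) x :=
    integral_nonneg hat fun x hx => (hb x (lt_of_lt_of_le hσa hx.1) (hx.2.trans htT)).1.le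
  -- bound `∫_a^T fp = ∫_a^b fp + ∫_b^T fp`
  have hsplit2 : ∫ x in a..T, P.fp om (P.βs om) x =
      (∫ x in a..b, P.fp om (P.βs om) x) + ∫ x in b..T, P.fp om (P.βs om) x :=
    (integral_add_adjacent_intervals (hfpi a b le_rfl hab hbT) (hfpi b T hab hbT le_rfl)).symm
  -- on `[a, b]`: `fp = fp a + P₁ - P₁ a + β ∫ψ ≤ (ε²/2 + ε²/4) + P₁`... integrate
  have hfa : |P.fp om (P.βs om) a - P.c₁| < P.ε ^ 2 / 4 := by
    rw [fp_indep_β hp hom hom8 _ hσa s2]; exact h2 _ ⟨by nlinarith, le_rfl⟩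
  rw [abs_lt] at hfa h6 h5
  have hI1 : ∫ x in a..b, P.fp om (P.βs om) x ≤ (P.Pi₁ b - P.Pi₁ a) + P.ε ^ 2 * (b - a) := by
    have hpt : ∀ x ∈ Icc a b, P.fp om (P.βs om) x ≤ P.P₁ x + P.ε ^ 2 := by
      intro x hx
      rw [fp_convex_eq hp hom hom8 (P.βs om) hx.1 (hx.2)]
      have hψI : |P.βs om * ∫ y in a..x, P.ψ y| ≤ P.ε / 4 * (x - a) := by
        rw [abs_mul]
        have h8 : |∫ y in a..x, P.ψ y| ≤ 1 * |x - a| :=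
          abs_integral_le_of_abs_le fun y _ => by rw [abs_of_nonneg (ψ_nonneg y)]; exact ψ_le_one y
        have hxa' : |x - a| = x - a := abs_of_nonneg (by linarith [hx.1])
        rw [hxa', one_mul] at h8
        exact mul_le_mul (by rw [abs_le]; constructor <;> linarith) h8 (abs_nonneg _) (by positivity)
      rw [abs_le] at hψI
      have hxa : x - a ≤ P.ε := by rw [ha]; nlinarith [hx.2]
      nlinarith [h.ε_le]
    have h1 : ∫ x in a..b, P.fp om (P.βs om) x ≤ ∫ x in a..b, (P.P₁ x + P.ε ^ 2) :=
      integral_mono_on hab (hfpi a b le_rfl hab hbT)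
        ((continuous_P₁.add continuous_const).intervalIntegrable _ _) hpt
    have h2 : ∫ x in a..b, (P.P₁ x + P.ε ^ 2) = (P.Pi₁ b - P.Pi₁ a) + P.ε ^ 2 * (b - a) := by
      rw [integral_add (continuous_P₁.intervalIntegrable _ _) (continuous_const.intervalIntegrable _ _),
        integral_eq_sub_of_hasDerivAt (fun x _ => hasDerivAt_Pi₁ x) (continuous_P₁.intervalIntegrable _ _),
        intervalIntegral.integral_const, smul_eq_mul]
      ring
    linarith
  -- on `[b, T]`: `fp ≤ gpε + 1`
  have hI2 : ∫ x in b..T, P.fp om (P.βs om) x ≤ (P.gpε + 1) * (T - b) := by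
    have h1 : ∫ x in b..T, P.fp om (P.βs om) x ≤ ∫ x in b..T, (P.gpε + 1) :=
      integral_mono_on hbT (hfpi b T hab hbT le_rfl) (continuous_const.intervalIntegrable _ _)
        fun x hx => by have := h3 x ⟨hx.1, hx.2⟩; rw [abs_lt] at this; linarith
    rwa [intervalIntegral.integral_const, smul_eq_mul, mul_comm] at h1
  have hTb : (P.gpε + 1) * (T - b) ≤ P.ε ^ 2 / 4 := by
    have hTb' : T - b = 2 * om * P.ε := by rw [hT, hbb]; ring
    rw [hTb']
    have : om * (8 * (P.gpε + 1) + 1) < P.ε := by rwa [lt_div_iff₀ (by positivity)] at homε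
    nlinarith
  have hPi := h.Pi₁_sub_le (by rw [ha]; nlinarith : P.η ≤ a) hab (by rw [hbb]; nlinarith : b ≤ P.ε)
  have hba : P.ε ^ 2 * (b - a) ≤ P.ε ^ 2 * P.ε := by
    apply mul_le_mul_of_nonneg_left _ (by positivity); rw [hbb, ha]; nlinarith
  have hgT : quadric P.l P.ε ≤ quadric P.l T := by
    rw [quadric, quadric]; apply Real.sqrt_le_sqrt
    have h1 : P.ε ^ 2 ≤ T ^ 2 := by rw [hT]; nlinarith
    nlinarith [mul_le_mul_of_nonneg_left h1 hp.l_nonneg]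
  -- assemble
  have key : P.ff om (P.βs om) (P.r₀s om) t = quadric P.l T - ∫ x in t..T, P.fp om (P.βs om) x := by
    linarith [hIt]
  rw [key, m₁]
  have hε3 : P.ε ^ 2 * P.ε ≤ P.ε ^ 2 / 2 := by nlinarith [h.ε_le, sq_nonneg P.ε]
  linarith [hsplit, hsplit2, hnn, hI1, hI2, hTb, hPi, hba, hgT]

end HParam

end Literature.Geometry.Symplectic

end
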